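import Literature.NumberTheory.ComplexMultiplication.CasselmanHeckeCharacterCMStructure
import Literature.NumberTheory.GaloisRepresentations.HeckeCharacterWeakApproximation
import Literature.NumberTheory.GaloisRepresentations.HeckeCharacterRamificationProofs
import Literature.NumberTheory.GaloisRepresentations.IntegralGaloisActionProofs
import Literature.AlgebraicGeometry.Motives.GoodReductionProofs
import Literature.AlgebraicGeometry.Motives.AbelianVarietyProjectiveChart
import Literature.AlgebraicGeometry.Motives.AbelianVarietyTateModuleFaithful
import Literature.AlgebraicGeometry.Motives.GaloisDescentAbelianVariety
import Literature.AlgebraicGeometry.Motives.AbelianVarietyEndGaloisDescent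
import Literature.AlgebraicGeometry.Motives.AbelianVarietyStructureDescent
import Literature.AlgebraicGeometry.ComplexMultiplication.CMTypeRealisationIsogenyTransport
import Literature.AlgebraicGeometry.ComplexMultiplication.CMAbelianVarietyRealisedHolds
import Literature.AlgebraicGeometry.ComplexMultiplication.CMTypeRealisationOverNumberFieldUniformized
import Literature.AlgebraicGeometry.ComplexMultiplication.CasselmanTwistedModel
import Literature.NumberTheory.ComplexMultiplication.CMTypeUniformization
import Literature.NumberTheory.ComplexMultiplication.MainTheoremOfComplexMultiplication
import Literature.NumberTheory.ComplexMultiplication.CasselmanLambdaFamily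
import Literature.NumberTheory.ComplexMultiplication.CasselmanTwistIdeleIndependence
import Literature.NumberTheory.ComplexMultiplication.CasselmanReciprocityOfDescent
import Literature.NumberTheory.ComplexMultiplication.ShimuraReciprocityFrobenius
import Literature.NumberTheory.ComplexMultiplication.ShimuraTaniyamaOfMainTheorem
import Literature.NumberTheory.ComplexMultiplication.CMDefinedOverNumberFieldOfQbar
import Literature.NumberTheory.DiophantineGeometry.AbelianVarietyOrdinaryReduction
import Summits.HodgeConjecture.CorCM.Hyp21.Hyp21FiniteLevelReciprocity
import Summits.HodgeConjecture.HodgeConjecture.Theses.HCCMUnconditional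
import HarnessLib

/-!
# `HCCMUnconditional.H21` from its residual named facts — the closing-file HEAD for item stmt-HodgeConjecture-24834
# (binder `h21` → `Hyp21`, [Shimura 1998, Thm. 21.4 / Casselman] AS PRINTED)

Topic: summit `HodgeConjecture`, sub-problem `HodgeConjecture`, route `HCCMUnconditional`, crux `H21` (= the pack decl
`PrintedCitationHypotheses.Hyp21 := shimura1998_thm21_4_casselman`, by `rfl`).  PROVER FILE (cell hodgecm-mathlib, D-0151
release track, ladder HODGECM-MATHLIB rung 0; seat A-p01; `--supports stmt-HodgeConjecture-24834`): sorry-free, axioms ⊆ trio,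
THEOREMS ONLY.

It is A-plan1's registered two-layer line `Cruxes/H21/Lines/a2_casselman_descent.lean` (v4) + sub-line
`Cruxes/H21/Lines/a2b_twisted_galois_model.lean` (v7) — whose crux workfiles are NOT importable (they carry the registered
stub slots) — with EVERY closed stub replaced BY NAME by its landed discharge and the FACT stubs left as explicit hypotheses,
so that the closing file of the item is the one-liner `H21_proof := H21_of_facts thm18_6_holds prop26_holds shimuraTaniyama_holds`
the day row II-1 (`shimura1998_thm18_6`, fan-B line `b2_main_theorem_cm`) lands:
* a2 `stub_existsOverNumberField` := A-p02's
  `Literature.AlgebraicGeometry.ComplexMultiplication.forall_exists_isCMTypeRealisationOver_uniformization_of_prop26` (p591969);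
* a2 `stub_descendStructure` (Weil descent of `(A₂, ι₂, ρ)`, Shimura Prop. 21.1) := A-p01's
  `Literature.AlgebraicGeometry.Motives.AbelianVariety.exists_descent_with_end` (p591059);
* a2b STUB 1 `stub_lambdaFamily` (p. 192 L4–9) := A-p03's `exists_iso_conjugate_of_isArtinLift_of_thm18_6` (p594140);
* a2b STUB 2a `stub_twistIdeleIndependent` (p. 192 L9–11) := A-p11's
  `unitEmbedding_mul_reflexNormFinitePart_inv_eq_of_isArtinLift` (p595386);
* a2b FL `stub_finiteLevelReciprocity` (p. 192 L12–14) := A-p01's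
  `Summit.HodgeConjecture.CorCM.Cruxes.Hyp21.TwistedGaloisModel.stub_finiteLevelReciprocity_holds` (p599969);
* a2b TM `stub_twistedModelOfFiniteLevel` (p. 192 L14–15) := A-p14's
  `Literature.AlgebraicGeometry.ComplexMultiplication.exists_twistedGaloisModel_of_finiteLevel` (p599130);
* a2b RD `stub_reciprocityOfDescent` (p. 192 L16–17) := A-p08's `exists_uniformization_shimuraReciprocity_of_descent` (p602563);
* a2b STUB 3 `stub_frobOfReciprocity` ((19.10g) ⟹ Frobenius, Thm. 19.11) := A-p04's `frobenius_of_shimuraReciprocity` (p594669).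
The compositions are those of the two workfiles, character for character: `cocycleDescent_holds` = a2b `stub_cocycleDescent`
(:= RD ∘ TM ∘ FL ∘ 2a), `twistedGaloisModel_of_thm18_6` = a2 `stub_twistedGaloisModel` (:= a2b `stub_twistedGaloisModel_of`),
`casselmanCore_of_facts` = a2 `stub_casselmanCore` (:= a2 `stub_casselmanCore_of`), `thm21_4_casselman_of_facts` = a2
`shimura1998_thm21_4_casselman_of`.

RESIDUAL HYPOTHESES of `H21_of_facts` (exactly the line's three registered FACT stubs, each a NAMED Literature `Prop`):
`h186 : shimura1998_thm18_6` (row II-1, [Shimura1998, Thm. 18.6], a2b `stub_thm18_6`), `h26 : shimura1998_prop26_definedOverNumberField`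
(row II-2, [Shimura1998, §12.4 Prop. 26], a2 `stub_prop26`), `hST : shimuraTaniyama_heckeCharacters` (row II-5, [Shimura1998, Prop. 19.10 /
Thm. 19.11], a2 `stub_shimuraTaniyama`).  The corollary `H21_of_thm18_6` pushes the last two down to their own landed reductions: row
II-2 ⇐ row II-2β `shimura1998_prop26_definedOverQbar` (B-p16 `shimura1998_prop26_definedOverNumberField_of_definedOverQbar`, p598725)
and row II-5 ⇐ row II-1 + the three reduction-theory records of `Motives/AbelianVarietyGoodReductionFrobenius` (A-p04
`shimuraTaniyama_heckeCharacters_of_thm18_6`, p600904).  HC_CM is proved only modulo the 7 printed citations until rung 0 closes;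
this file discharges no binder by itself.

## References
* [Shimura1998] G. Shimura, *Abelian Varieties with Complex Multiplication and Modular Functions*, Princeton Univ. Press (1998):
  §21.4 Thm. 21.4 and its proof (p. 192); §21.1 Prop. 21.1 (pp. 189–191); §18.6 Thm. 18.6 (2); §12.4 Prop. 26; Prop. 19.10,
  Thm. 19.11, (19.10g) (p. 137).
* [SerreTate1968] J.-P. Serre, J. Tate, *Good reduction of abelian varieties*, Ann. of Math. 88 (1968), §7 Thm. 10–12.
* [Milne1986JacobianVarieties] J. S. Milne, *Jacobian varieties*, in Cornell–Silverman (1986), §1, 1.9 (Weil descent).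
-/

set_option autoImplicit false

open CategoryTheory IsDedekindDomain
open NumberField hiding ideleGroup
open scoped NumberField ComplexConjugate nonZeroDivisors

namespace Summit.HodgeConjecture.CorCM.Hyp21

open Literature.AlgebraicGeometry.Motives
open Literature.NumberTheory.GaloisRepresentations
open Literature.NumberTheory.ComplexMultiplication
open Literature.NumberTheory.NumberFields.IdeleAction (ideleMulIdeal ideleMulEquiv)
open Literature.NumberTheory.AdelicBaseChange (ideleRelNorm)
open Literature.AlgebraicGeometry.ComplexMultiplication (IsCMTypeRealisation exists_isCMTypeRealisation)
open MonoidalCategory CartesianMonoidalCategory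
open scoped MonObj

/-! ## Layer 3 (sub-line a2b): the twisted Galois model from Thm. 18.6 (2) -/

/-- **a2b `stub_cocycleDescent` (Shimura p. 192 L9–17 + Prop. 21.1), PROVED := RD ∘ TM ∘ FL ∘ 2a by name.**  From the
λ-family of STUB 1: a structure `(A₂, ι₂)` of type `(K, Φ)` over a finite Galois `k₂ / k` inside `ℂ` with a semilinear
`Gal(k₂/k)`-action `ρ` compatible with `μ, η, ι⁻¹` and every `ι₂(a)`, every `k`-descent `(A₀, e, ι₀)` of which satisfies
Shimura reciprocity (19.10g) for some uniformisation `ξ₁` of `A₀(ℂ)` of type `(K, Φ, 𝔞)`.  Statement = a2b v7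
`stub_cocycleDescent` character for character; proof = a2b's `stub_cocycleDescentOfIndep` ∘ `stub_twistIdeleIndependent` with
2a := `unitEmbedding_mul_reflexNormFinitePart_inv_eq_of_isArtinLift` (A-p11), FL := `stub_finiteLevelReciprocity_holds` (A-p01),
TM := `exists_twistedGaloisModel_of_finiteLevel` (A-p14), RD := `exists_uniformization_shimuraReciprocity_of_descent` (A-p08).
[cite: Shimura1998, §21.4 proof p. 192 L9–17; §21.1 Prop. 21.1 pp. 189–191; (19.10g) p. 137] -/
theorem cocycleDescent_holds :
    ∀ (k : Type) [Field k] [NumberField k] [Algebra k ℂ] (K : Type) [Field K] [NumberField K]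
      [IsCMField K] (Φ : CMType K) (τ₀ : K →+* ℂ) (χ : HeckeCharacter k),
    ((traceField Φ : Set ℂ) ⊆ Set.range (algebraMap k ℂ)) →
    χ.HasInfinityType (cmInfinityType Φ.1 τ₀ (algebraMap k ℂ)).1
      (cmInfinityType Φ.1 τ₀ (algebraMap k ℂ)).2 →
    (∀ x : ideleGroup k, (x : AdeleRing (𝓞 k) k).1 = 1 →
      (∃ b : K, ((χ x : ℂˣ) : ℂ) = τ₀ b) ∧
        ((χ x : ℂˣ) : ℂ) * conj ((χ x : ℂˣ) : ℂ) = (((ideleNorm x)⁻¹ : ℝ) : ℂ)) →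
    (∀ (v : HeightOneSpectrum (𝓞 k)) (u : (v.adicCompletionIntegers k)ˣ),
      ∃ b : (𝓞 K)ˣ, ((χ.localComponent v
        (Units.map ((v.adicCompletionIntegers k).subtype : _ →* _) u) : ℂˣ) : ℂ) =
        τ₀ ((b : 𝓞 K) : K)) →
    (∀ v : HeightOneSpectrum (𝓞 k), ∃ π : 𝓞 K, χ.valueAtUniformizer v = τ₀ (π : K) ∧
      ∀ (L : Type) [Field L] [NumberField L] [Normal ℚ L] (ιL : L →+* ℂ) (j : K →+* L)
        (σL : k →+* L), ιL.comp σL = algebraMap k ℂ →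
        IsReflexTypeNorm (valuedIn ιL Φ.1) j σL v.asIdeal (Ideal.span {π})) →
    ∀ (k₁ : Type) [Field k₁] [NumberField k₁] [Algebra k₁ ℂ] (A₁ : AbelianVariety k₁)
      (ι₁ : 𝓞 K →+* End A₁), IsCMTypeRealisationOver Φ A₁ ι₁ →
    ∀ (𝔞 : (FractionalIdeal (𝓞 K)⁰ K)ˣ)
      (ξ : CMTypeUniformization Φ 𝔞 (A₁.baseChange ℂ) ((A₁.endBaseChange ℂ).comp ι₁)),
    (∀ [NumberField ↥(traceField Φ)] [Algebra ↥(traceField Φ) k] [IsScalarTower ↥(traceField Φ) k ℂ]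
        (σ : ℂ ≃ₐ[k] ℂ) (y : ideleGroup k), IsArtinLift k y σ →
        ∀ b : Kˣ, ((χ ((infiniteIdeles k (HeckeCharacter.infPart k y))⁻¹ * y) : ℂˣ) : ℂ) = τ₀ (b : K) →
        ∃ lam : A₁.baseChange ℂ ≅ (A₁.baseChange ℂ).conjugate σ.toRingEquiv,
          (∀ a : 𝓞 K, ((A₁.endBaseChange ℂ).comp ι₁ a : _ ⟶ _) ≫ lam.hom =
            lam.hom ≫ (((A₁.baseChange ℂ).endConjugate σ.toRingEquiv) ((A₁.endBaseChange ℂ).comp ι₁ a) : _ ⟶ _)) ∧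
          ∀ u v : K,
            ideleMulEquiv (FiniteAdeleRing.unitEmbedding (𝓞 K) K b * (reflexNormFinitePart K Φ (traceField Φ) (ideleRelNorm (↥(traceField Φ)) k y))⁻¹)
              (𝔞 : FractionalIdeal (𝓞 K)⁰ K) 𝔞.ne_zero (Submodule.Quotient.mk u) = Submodule.Quotient.mk v →
            (A₁.baseChange ℂ).conjPoints σ.toRingEquiv (ξ.r u) = AlgPoints.map lam.hom.hom.hom.hom (ξ.r v)) →
    ∃ (k₂ : Type) (_ : Field k₂) (_ : NumberField k₂) (_ : Algebra k k₂) (_ : Algebra k₂ ℂ)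
      (_ : IsScalarTower k k₂ ℂ) (_ : FiniteDimensional k k₂) (_ : IsGalois k k₂)
      (A₂ : AbelianVariety k₂) (ι₂ : 𝓞 K →+* End A₂)
      (ρ : Literature.AlgebraicGeometry.RelativeSpec.ActionOver
        (A₂.X.hom ≫ AbelianVariety.bcSpec k k₂) (k₂ ≃ₐ[k] k₂))
      (hρ : ∀ σ, (ρ.aut σ).hom ≫ A₂.X.hom = A₂.X.hom ≫ AbelianVariety.specAut k₂ σ⁻¹),
      IsCMTypeRealisationOver Φ A₂ ι₂ ∧
      (∀ σ, GaloisDescentAbelianVariety.aut₂ k₂ A₂ ρ hρ σ ≫ μ[A₂.X].left = μ[A₂.X].left ≫ (ρ.aut σ).hom) ∧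
      (∀ σ, η[A₂.X].left ≫ (ρ.aut σ).hom = AbelianVariety.specAut k₂ σ⁻¹ ≫ η[A₂.X].left) ∧
      (∀ σ, ι[A₂.X].left ≫ (ρ.aut σ).hom = (ρ.aut σ).hom ≫ ι[A₂.X].left) ∧
      (∀ σ (a : 𝓞 K), (ρ.aut σ).hom ≫ AbelianVariety.Hom.toSchemeHom (ι₂ a : A₂ ⟶ A₂) =
        AbelianVariety.Hom.toSchemeHom (ι₂ a : A₂ ⟶ A₂) ≫ (ρ.aut σ).hom) ∧
      ∀ (A₀ : AbelianVariety k) (e : A₂ ≅ A₀.baseChange k₂),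
        (∀ σ, (ρ.aut σ).hom ≫ AbelianVariety.Hom.toSchemeHom e.hom =
          AbelianVariety.Hom.toSchemeHom e.hom ≫ A₀.gal k₂ σ) →
        ∀ ι₀ : 𝓞 K →+* End A₀,
          (∀ a : 𝓞 K, (ι₂ a : A₂ ⟶ A₂) ≫ e.hom = e.hom ≫ AbelianVariety.Hom.baseChange k₂ (ι₀ a : A₀ ⟶ A₀)) →
      (∃ ξ₁ : CMTypeUniformization Φ 𝔞 A₀ ι₀,
      ∀ [NumberField ↥(traceField Φ)] [Algebra ↥(traceField Φ) k] [IsScalarTower ↥(traceField Φ) k ℂ]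
        (σ : ℂ ≃ₐ[k] ℂ) (y : ideleGroup k), IsArtinLift k y σ →
        ∀ b : Kˣ, ((χ ((infiniteIdeles k (HeckeCharacter.infPart k y))⁻¹ * y) : ℂˣ) : ℂ) = τ₀ (b : K) →
          ∀ u v : K,
            ideleMulEquiv (FiniteAdeleRing.unitEmbedding (𝓞 K) K b * (reflexNormFinitePart K Φ (traceField Φ) (ideleRelNorm (↥(traceField Φ)) k y))⁻¹)
              (𝔞 : FractionalIdeal (𝓞 K)⁰ K) 𝔞.ne_zero (Submodule.Quotient.mk u) = Submodule.Quotient.mk v →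
            σ • ξ₁.r u = ξ₁.r v) := by
  intro k _ _ _ K _ _ _ Φ τ₀ χ hK ha hb hu hπ k₁ _ _ _ A₁ ι₁ hA₁ 𝔞 ξ hlam
  have hindep := @unitEmbedding_mul_reflexNormFinitePart_inv_eq_of_isArtinLift k _ _ _ K _ _ _ Φ τ₀ χ hK ha hb hu hπ
  obtain ⟨k₂, _i1, _i2, _i3, _i4, _i5, _i6, _i7, _i8, _i9, hfl⟩ :=
    Summit.HodgeConjecture.CorCM.Cruxes.Hyp21.TwistedGaloisModel.stub_finiteLevelReciprocity_holds k K Φ τ₀ χ hK ha hb hu hπ k₁ A₁ ι₁ hA₁ 𝔞 ξ hlam hindep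
  obtain ⟨A₂, ι₂, ρ, hρ, h1, hmul, hone, hinv, hιρ, e₂, he₂, hlink⟩ :=
    Literature.AlgebraicGeometry.ComplexMultiplication.exists_twistedGaloisModel_of_finiteLevel
      k K Φ τ₀ χ hK ha hb hu hπ k₁ A₁ ι₁ hA₁ 𝔞 ξ hlam hindep k₂ hfl
  exact ⟨k₂, _i1, _i2, _i3, _i4, _i5, _i6, _i7, A₂, ι₂, ρ, hρ, h1, hmul, hone, hinv, hιρ,
    fun A₀ e he ι₀ hι ↦ exists_uniformization_shimuraReciprocity_of_descent k K Φ τ₀ χ hK ha hb hu hπ k₁ A₁ ι₁ hA₁ 𝔞 ξ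
      hlam hindep k₂ A₂ ι₂ ρ hρ e₂ he₂ hlink A₀ e he ι₀ hι⟩

/-- **a2 `stub_twistedGaloisModel` from Thm. 18.6 (2) (interface leaf II-1′ of line `a2_casselman_descent`, PROVED modulo the
named fact `shimura1998_thm18_6`).**  Under the hypotheses of Thm. 21.4 and given a structure `(A₁, ι₁)` of type `(K, Φ)` over a
number field `k₁ ⊂ ℂ` with a complex uniformisation `ξ` of type `(K, Φ, 𝔞)`: a finite Galois `k₂ / k`, a structure `(A₂, ι₂)`
of type `(K, Φ)` over `k₂` and a semilinear `Gal(k₂/k)`-action `ρ` compatible with the group law and `ι₂`, such that every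
`ρ`-compatible `k`-form `(A₀, ι₀)` «determines `χ`» in the Frobenius form (19.10g).  Statement = a2 v4 `stub_twistedGaloisModel`
character for character, with `shimura1998_thm18_6` as the explicit antecedent; proof = a2b v7 `stub_twistedGaloisModel_of` with
STUB 1 := `exists_iso_conjugate_of_isArtinLift_of_thm18_6` (A-p03), STUB 2 := `cocycleDescent_holds`, STUB 3 :=
`frobenius_of_shimuraReciprocity` (A-p04).
[cite: Shimura1998, §18.6 Thm. 18.6 (2); §21.1 Prop. 21.1; §21.4 proof p. 192; (19.10g); Thm. 19.11] -/
theorem twistedGaloisModel_of_thm18_6 (h186 : shimura1998_thm18_6) :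
    ∀ (k : Type) [Field k] [NumberField k] [Algebra k ℂ] (K : Type) [Field K] [NumberField K]
      [IsCMField K] (Φ : CMType K) (τ₀ : K →+* ℂ) (χ : HeckeCharacter k),
    ((traceField Φ : Set ℂ) ⊆ Set.range (algebraMap k ℂ)) →
    χ.HasInfinityType (cmInfinityType Φ.1 τ₀ (algebraMap k ℂ)).1
      (cmInfinityType Φ.1 τ₀ (algebraMap k ℂ)).2 →
    (∀ x : ideleGroup k, (x : AdeleRing (𝓞 k) k).1 = 1 →
      (∃ b : K, ((χ x : ℂˣ) : ℂ) = τ₀ b) ∧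
        ((χ x : ℂˣ) : ℂ) * conj ((χ x : ℂˣ) : ℂ) = (((ideleNorm x)⁻¹ : ℝ) : ℂ)) →
    (∀ (v : HeightOneSpectrum (𝓞 k)) (u : (v.adicCompletionIntegers k)ˣ),
      ∃ b : (𝓞 K)ˣ, ((χ.localComponent v
        (Units.map ((v.adicCompletionIntegers k).subtype : _ →* _) u) : ℂˣ) : ℂ) =
        τ₀ ((b : 𝓞 K) : K)) →
    (∀ v : HeightOneSpectrum (𝓞 k), ∃ π : 𝓞 K, χ.valueAtUniformizer v = τ₀ (π : K) ∧
      ∀ (L : Type) [Field L] [NumberField L] [Normal ℚ L] (ιL : L →+* ℂ) (j : K →+* L)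
        (σL : k →+* L), ιL.comp σL = algebraMap k ℂ →
        IsReflexTypeNorm (valuedIn ιL Φ.1) j σL v.asIdeal (Ideal.span {π})) →
    ∀ (k₁ : Type) [Field k₁] [NumberField k₁] [Algebra k₁ ℂ] (A₁ : AbelianVariety k₁)
      (ι₁ : 𝓞 K →+* End A₁), IsCMTypeRealisationOver Φ A₁ ι₁ →
    ∀ 𝔞 : (FractionalIdeal (𝓞 K)⁰ K)ˣ,
      CMTypeUniformization Φ 𝔞 (A₁.baseChange ℂ) ((A₁.endBaseChange ℂ).comp ι₁) →
    ∃ (k₂ : Type) (_ : Field k₂) (_ : NumberField k₂) (_ : Algebra k k₂) (_ : Algebra k₂ ℂ)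
      (_ : IsScalarTower k k₂ ℂ) (_ : FiniteDimensional k k₂) (_ : IsGalois k k₂)
      (A₂ : AbelianVariety k₂) (ι₂ : 𝓞 K →+* End A₂)
      (ρ : Literature.AlgebraicGeometry.RelativeSpec.ActionOver
        (A₂.X.hom ≫ AbelianVariety.bcSpec k k₂) (k₂ ≃ₐ[k] k₂))
      (hρ : ∀ σ, (ρ.aut σ).hom ≫ A₂.X.hom = A₂.X.hom ≫ AbelianVariety.specAut k₂ σ⁻¹),
      IsCMTypeRealisationOver Φ A₂ ι₂ ∧
      (∀ σ, GaloisDescentAbelianVariety.aut₂ k₂ A₂ ρ hρ σ ≫ μ[A₂.X].left = μ[A₂.X].left ≫ (ρ.aut σ).hom) ∧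
      (∀ σ, η[A₂.X].left ≫ (ρ.aut σ).hom = AbelianVariety.specAut k₂ σ⁻¹ ≫ η[A₂.X].left) ∧
      (∀ σ, ι[A₂.X].left ≫ (ρ.aut σ).hom = (ρ.aut σ).hom ≫ ι[A₂.X].left) ∧
      (∀ σ (a : 𝓞 K), (ρ.aut σ).hom ≫ AbelianVariety.Hom.toSchemeHom (ι₂ a : A₂ ⟶ A₂) =
        AbelianVariety.Hom.toSchemeHom (ι₂ a : A₂ ⟶ A₂) ≫ (ρ.aut σ).hom) ∧
      ∀ (A₀ : AbelianVariety k) (e : A₂ ≅ A₀.baseChange k₂),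
        (∀ σ, (ρ.aut σ).hom ≫ AbelianVariety.Hom.toSchemeHom e.hom =
          AbelianVariety.Hom.toSchemeHom e.hom ≫ A₀.gal k₂ σ) →
        ∀ ι₀ : 𝓞 K →+* End A₀,
          (∀ a : 𝓞 K, (ι₂ a : A₂ ⟶ A₂) ≫ e.hom = e.hom ≫ AbelianVariety.Hom.baseChange k₂ (ι₀ a : A₀ ⟶ A₀)) →
      ∀ v : HeightOneSpectrum (𝓞 k), χ.IsUnramifiedAt v →
        ∃ π : 𝓞 K, χ.valueAtUniformizer v = τ₀ (π : K) ∧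
          ∀ (ℓ : ℕ) [Fact ℓ.Prime], (ℓ : 𝓞 k) ∉ v.asIdeal →
            ∀ 𝔓 ∈ v.primesAbove, ∀ σ : Field.absoluteGaloisGroup k, IsArithFrobAt (𝓞 k) σ 𝔓 →
              A₀.tateRep ℓ σ = AbelianVariety.tateModuleMap ℓ (ι₀ π : A₀ ⟶ A₀) := by
  intro k _ _ _ K _ _ _ Φ τ₀ χ hK ha hb hu hπ k₁ _ _ _ A₁ ι₁ hA₁ 𝔞 ξ
  have hlam := @exists_iso_conjugate_of_isArtinLift_of_thm18_6 h186 k _ _ _ K _ _ _ Φ τ₀ χ hK ha hb hu hπ k₁ _ _ _ A₁ ι₁ hA₁ 𝔞 ξ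
  obtain ⟨k₂, _j1, _j2, _j3, _j4, _j5, _j6, _j7, A₂, ι₂, ρ, hρ, hA₂, hmul, hone, hinv, hιρ, hrec⟩ :=
    cocycleDescent_holds k K Φ τ₀ χ hK ha hb hu hπ k₁ A₁ ι₁ hA₁ 𝔞 ξ hlam
  refine ⟨k₂, _j1, _j2, _j3, _j4, _j5, _j6, _j7, A₂, ι₂, ρ, hρ, hA₂, hmul, hone, hinv, hιρ, ?_⟩
  intro A₀ e he ι₀ hι
  have h₂' : IsCMTypeRealisationOver Φ (A₀.baseChange k₂) ((A₀.endBaseChange k₂).comp ι₀) :=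
    (IsCMTypeRealisationOver.iff_of_iso e (fun a => by
      simpa only [RingHom.comp_apply, AbelianVariety.endBaseChange_apply] using hι a)).1 hA₂
  exact frobenius_of_shimuraReciprocity k K Φ τ₀ χ hK ha hb hu hπ 𝔞 A₀ ι₀ (IsCMTypeRealisationOver.of_baseChange h₂')
    (hrec A₀ e he ι₀ hι)

/-! ## Layer 2 (line a2): Casselman core ⟸ Prop. 12.26 + twisted Galois model + Weil descent -/

/-- **a2 `stub_casselmanCore` (Shimura 1998 Thm. 21.4 verbatim, Frobenius form of «determines `χ`»), PROVED modulo the named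
facts `shimura1998_prop26_definedOverNumberField` (row II-2) and `shimura1998_thm18_6` (row II-1).**  «There exists a structure
`𝒫` of type `(K, Φ)` rational over `k` which determines `χ`» (p. 192), (19.10g) read on `ℓ`-power torsion at the good unramified
places.  Statement = a2 v4 `stub_casselmanCore` character for character; proof = a2 `stub_casselmanCore_of` with
`stub_existsOverNumberField` := `forall_exists_isCMTypeRealisationOver_uniformization_of_prop26` (A-p02), `stub_twistedGaloisModel` :=
`twistedGaloisModel_of_thm18_6`, `stub_descendStructure` := `AbelianVariety.exists_descent_with_end` (A-p01): the type `(K, Φ)`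
descends from `A₂` to the `k`-form `A₀` along `e : A₂ ≅ A₀ ⊗ k₂` (`IsCMTypeRealisationOver.iff_of_iso`, `.of_baseChange`).
[cite: Shimura1998, §21.4 Thm. 21.4 (proof, p. 192); §12.4 Prop. 26; §21.1 Prop. 21.1] -/
theorem casselmanCore_of_facts (h26 : shimura1998_prop26_definedOverNumberField) (h186 : shimura1998_thm18_6) :
    ∀ (k : Type) [Field k] [NumberField k] [Algebra k ℂ] (K : Type) [Field K] [NumberField K]
      [IsCMField K] (Φ : CMType K) (τ₀ : K →+* ℂ) (χ : HeckeCharacter k),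
    ((traceField Φ : Set ℂ) ⊆ Set.range (algebraMap k ℂ)) →
    χ.HasInfinityType (cmInfinityType Φ.1 τ₀ (algebraMap k ℂ)).1
      (cmInfinityType Φ.1 τ₀ (algebraMap k ℂ)).2 →
    (∀ x : ideleGroup k, (x : AdeleRing (𝓞 k) k).1 = 1 →
      (∃ b : K, ((χ x : ℂˣ) : ℂ) = τ₀ b) ∧
        ((χ x : ℂˣ) : ℂ) * conj ((χ x : ℂˣ) : ℂ) = (((ideleNorm x)⁻¹ : ℝ) : ℂ)) →
    (∀ (v : HeightOneSpectrum (𝓞 k)) (u : (v.adicCompletionIntegers k)ˣ),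
      ∃ b : (𝓞 K)ˣ, ((χ.localComponent v
        (Units.map ((v.adicCompletionIntegers k).subtype : _ →* _) u) : ℂˣ) : ℂ) =
        τ₀ ((b : 𝓞 K) : K)) →
    (∀ v : HeightOneSpectrum (𝓞 k), ∃ π : 𝓞 K, χ.valueAtUniformizer v = τ₀ (π : K) ∧
      ∀ (L : Type) [Field L] [NumberField L] [Normal ℚ L] (ιL : L →+* ℂ) (j : K →+* L)
        (σL : k →+* L), ιL.comp σL = algebraMap k ℂ →
        IsReflexTypeNorm (valuedIn ιL Φ.1) j σL v.asIdeal (Ideal.span {π})) →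
    ∃ (A₀ : AbelianVariety k) (ι₀ : 𝓞 K →+* End A₀),
      IsCMTypeRealisationOver Φ A₀ ι₀ ∧
      ∀ v : HeightOneSpectrum (𝓞 k), χ.IsUnramifiedAt v →
        ∃ π : 𝓞 K, χ.valueAtUniformizer v = τ₀ (π : K) ∧
          ∀ (ℓ : ℕ) [Fact ℓ.Prime], (ℓ : 𝓞 k) ∉ v.asIdeal →
            ∀ 𝔓 ∈ v.primesAbove, ∀ σ : Field.absoluteGaloisGroup k, IsArithFrobAt (𝓞 k) σ 𝔓 →
              A₀.tateRep ℓ σ = AbelianVariety.tateModuleMap ℓ (ι₀ π : A₀ ⟶ A₀) := by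
  intro k _ _ _ K _ _ _ Φ τ₀ χ hK ha hb hu hπ
  obtain ⟨k₁, _i1, _i2, _i3, A₁, ι₁, hA₁, 𝔞, ⟨ξ⟩⟩ :=
    Literature.AlgebraicGeometry.ComplexMultiplication.forall_exists_isCMTypeRealisationOver_uniformization_of_prop26 h26 K Φ
  obtain ⟨k₂, _j1, _j2, _j3, _j4, _j5, _j6, _j7, A₂, ι₂, ρ, hρ, hA₂, hmul, hone, hinv, hιρ, hfrob⟩ :=
    twistedGaloisModel_of_thm18_6 h186 k K Φ τ₀ χ hK ha hb hu hπ k₁ A₁ ι₁ hA₁ 𝔞 ξ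
  obtain ⟨A₀, e, ι₀, he, hι⟩ := AbelianVariety.exists_descent_with_end k₂ A₂ ρ hρ hmul hone hinv K ι₂ hιρ
  refine ⟨A₀, ι₀, ?_, hfrob A₀ e he ι₀ hι⟩
  have h₂' : IsCMTypeRealisationOver Φ (A₀.baseChange k₂) ((A₀.endBaseChange k₂).comp ι₀) :=
    (IsCMTypeRealisationOver.iff_of_iso e (fun a => by
      simpa only [RingHom.comp_apply, AbelianVariety.endBaseChange_apply] using hι a)).1 hA₂
  exact IsCMTypeRealisationOver.of_baseChange h₂'

/-! ## Layer 1 (line a2): Casselman core + Shimura–Taniyama ⟹ binder -/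

/-- **The `𝓞_K`-action of a structure of type `(K, Φ)` is injective** (the CM type is read through
a ring homomorphism `θ : K → End_ℂ H¹(A₀(ℂ), ℂ)` out of a field into the endomorphisms of a
non-zero space, `rk H¹ = [K : ℚ] > 0`, and `θ(a) = H¹(ι₀(a)_ℂ)`). [cite: Shimura1998, §5.2 and §19.7] -/
theorem injective_of_isCMTypeRealisationOver {k : Type} [Field k] [Algebra k ℂ] {K : Type} [Field K]
    [NumberField K] {Φ : CMType K} {A₀ : AbelianVariety k} {ι₀ : 𝓞 K →+* End A₀}
    (h : IsCMTypeRealisationOver Φ A₀ ι₀) : Function.Injective ι₀ := by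
  obtain ⟨θ, hθ⟩ := h
  obtain ⟨-, hrank, hcomp, -⟩ := hθ
  intro a b hab
  have hV : Nontrivial (Literature.AlgebraicGeometry.HodgeTheory.complexBetti (A₀.baseChange ℂ).X 1) := by
    apply Module.nontrivial_of_finrank_pos (R := ℂ)
    rw [hrank]
    exact Module.finrank_pos
  have hab' : ((A₀.endBaseChange ℂ).comp ι₀) a = ((A₀.endBaseChange ℂ).comp ι₀) b := by
    simp only [RingHom.comp_apply, hab]
  have ha := hcomp a
  rw [hab', hcomp b] at ha
  have hK : (a : K) = (b : K) := θ.injective ha.symm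
  exact NumberField.RingOfIntegers.ext hK

/-- **Some prime `ℓ` is prime to `v`** (of `2` and `3`, not both lie in the prime `v`). [folklore] -/
theorem exists_prime_natCast_notMem {k : Type} [Field k] [NumberField k]
    (v : HeightOneSpectrum (𝓞 k)) : ∃ ℓ : ℕ, ℓ.Prime ∧ (ℓ : 𝓞 k) ∉ v.asIdeal := by
  by_contra h
  push Not at h
  have h2 := h 2 Nat.prime_two
  have h3 := h 3 Nat.prime_three
  have h1 : ((3 : ℕ) : 𝓞 k) - ((2 : ℕ) : 𝓞 k) ∈ v.asIdeal := v.asIdeal.sub_mem h3 h2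
  have h1' : ((3 : ℕ) : 𝓞 k) - ((2 : ℕ) : 𝓞 k) = 1 := by push_cast; norm_num
  rw [h1'] at h1
  exact v.isPrime.ne_top ((Ideal.eq_top_iff_one _).2 h1)

/-- **Shimura 1998 Thm. 21.4 (Casselman) in the binder's form `shimura1998_thm21_4_casselman`, PROVED modulo the three named facts
`shimura1998_thm18_6` (II-1), `shimura1998_prop26_definedOverNumberField` (II-2), `shimuraTaniyama_heckeCharacters` (II-5).**  Shimura
p. 192, last paragraph, made explicit (a2 `shimura1998_thm21_4_casselman_of` character for character with `hcore := casselmanCore_of_facts`):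
let `(A₀, ι₀)` be the structure of the Casselman core and `(χ_τ)` its Shimura–Taniyama family; at every place `v` good for `A₀`
(cofinitely many) and unramified for `χ` (cofinitely many) both `χ_{τ₀}(ϖ_v) = τ₀ π` and `χ(ϖ_v) = τ₀ π'` come with «Frobenius =
`ι₀(π)`», «Frobenius = `ι₀(π')`» on `T_ℓ A₀` (`ℓ ∈ {2, 3}` prime to `v`), so `ι₀ π = ι₀ π'` (`hom_ext_of_tateModuleMap_eq`), `π = π'`,
hence `χ_{τ₀} = χ` (`HeckeCharacter.ext_of_eventually_valueAtUniformizer_eq`); the remaining (Frobenius) clause is clause (5a,b) of the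
family.  Edition E-19.11♭1: the binder reads Thm. 21.4 + Prop. 19.10 WITHOUT Thm. 19.11's «`χ` unramified at `v` ⇔ `A₀` good at `v`»,
so clause (4) of the family is no longer read here.  Edition E-ST: the binder's Frobenius clause is keyed on «good reduction
modulo `𝔭`» = an abelian-scheme model over `𝓞_{k,v}` ([SerreTate1968] §1, `IsAbelianSchemeModel`), which implies the family's
smooth-proper key `HasGoodReductionAt` (`IsAbelianSchemeModel.hasGoodReductionAt`) — so clause (5a,b) is read at `h𝒜.hasGoodReductionAt`.
[cite: Shimura1998, §21.4 Thm. 21.4 (proof, p. 192)] [cite: SerreTate1968, §1 (definition of good reduction, p. 492)] -/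
theorem thm21_4_casselman_of_facts (h186 : shimura1998_thm18_6) (h26 : shimura1998_prop26_definedOverNumberField)
    (hST : shimuraTaniyama_heckeCharacters) : shimura1998_thm21_4_casselman := by
  have hcore := casselmanCore_of_facts h26 h186
  intro k _ _ _ K _ _ _ Φ τ₀ χ hK ha hb hu hπ
  obtain ⟨A₀, ι₀, hreal, hfrob⟩ := hcore k K Φ τ₀ χ hK ha hb hu hπ
  obtain ⟨χfam, h1, h2, h3, -, h5⟩ := hST k K Φ A₀ ι₀ hreal
  have hιinj : Function.Injective ι₀ := injective_of_isCMTypeRealisationOver hreal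
  -- cofinitely many good places
  have hgood : ∀ᶠ v in Filter.cofinite, HasGoodReductionAt A₀.X A₀.dim v := by
    obtain ⟨S, hS, hout⟩ := exists_finite_hasGoodReductionOutside_holds (X := A₀.X) (n := A₀.dim)
      A₀.isSmoothProjective_holds
    exact Filter.eventually_cofinite.2 (hS.subset fun v hv => by
      by_contra hvS
      exact hv (hout v hvS))
  -- cofinitely many unramified places
  have hunr : ∀ᶠ v in Filter.cofinite, χ.IsUnramifiedAt v :=
    (χ.finite_ramifiedPlaces_iff).1 (HeckeCharacter.finite_ramifiedPlaces_holds χ)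
  -- the two Frobenius descriptions agree there
  have hev : ∀ᶠ v in Filter.cofinite, (χfam τ₀).valueAtUniformizer v = χ.valueAtUniformizer v := by
    refine (hgood.and hunr).mono fun v hv => ?_
    obtain ⟨hv1, hv2⟩ := hv
    obtain ⟨π, hπval, hπfrob, -⟩ := h5 v hv1
    obtain ⟨π', hπ'val, hπ'frob⟩ := hfrob v hv2
    obtain ⟨ℓ, hℓprime, hℓv⟩ := exists_prime_natCast_notMem v
    haveI : Fact ℓ.Prime := ⟨hℓprime⟩
    obtain ⟨𝔓, h𝔓⟩ := v.primesAbove_nonempty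
    obtain ⟨σ, hσ⟩ :=
      IsDedekindDomain.HeightOneSpectrum.exists_isArithFrobAt_of_mem_primesAbove_holds (K := k) (v := v) h𝔓
    have e1 := hπfrob ℓ hℓv 𝔓 h𝔓 σ hσ
    have e2 := hπ'frob ℓ hℓv 𝔓 h𝔓 σ hσ
    have hℓk : (ℓ : k) ≠ 0 := Nat.cast_ne_zero.2 hℓprime.ne_zero
    have hιeq : (ι₀ π : A₀ ⟶ A₀) = ι₀ π' :=
      AbelianVariety.hom_ext_of_tateModuleMap_eq ℓ hℓk (e1.symm.trans e2)
    have hππ' : π = π' := hιinj hιeq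
    rw [hπval τ₀, hπ'val, hππ']
  have heq : χfam τ₀ = χ := HeckeCharacter.ext_of_eventually_valueAtUniformizer_eq hev
  refine ⟨A₀, ι₀, hreal, χfam, heq, fun v hv => ?_⟩
  obtain ⟨𝒜, _, h𝒜⟩ := hv
  obtain ⟨π, hπa, hπb, -⟩ := h5 v h𝒜.hasGoodReductionAt
  exact ⟨π, hπa, hπb⟩

/-- **CLOSING-FILE HEAD of item stmt-HodgeConjecture-24834 (route `HCCMUnconditional`, crux `H21 := PrintedCitationHypotheses.Hyp21 :=
shimura1998_thm21_4_casselman`, both by `rfl`), modulo EXACTLY the line's three registered fact stubs:** `h186 : shimura1998_thm18_6`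
(row II-1, a2b `stub_thm18_6`), `h26 : shimura1998_prop26_definedOverNumberField` (row II-2, a2 `stub_prop26`), `hST :
shimuraTaniyama_heckeCharacters` (row II-5, a2 `stub_shimuraTaniyama`).  Every other stub of `a2_casselman_descent` v4 /
`a2b_twisted_galois_model` v7 is filled BY NAME (module docstring).  The closing one-liner of the item is
`H21_proof := H21_of_facts ‹thm18_6› ‹prop26› ‹shimuraTaniyama›` the day those land.  HC_CM is proved only modulo the 7 printed
citations until rung 0 closes.  [cite: Shimura1998, §21.4 Thm. 21.4] -/
theorem H21_of_facts (h186 : shimura1998_thm18_6) (h26 : shimura1998_prop26_definedOverNumberField)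
    (hST : shimuraTaniyama_heckeCharacters) : Summit.HodgeConjecture.HodgeConjecture.Theses.HCCMUnconditional.H21 :=
  thm21_4_casselman_of_facts h186 h26 hST

/-- **The same head with rows II-2 and II-5 pushed down to their landed reductions:** `HCCMUnconditional.H21` from `shimura1998_thm18_6`
(row II-1), the `ℚ̄`-form `shimura1998_prop26_definedOverQbar` of Prop. 12.26 (row II-2β; row II-2 ⇐ II-2β is B-p16's
`shimura1998_prop26_definedOverNumberField_of_definedOverQbar`, EGA IV₃ 8.8.2) and, at every finite place of every number field, the three
reduction-theory records of `Motives/AbelianVarietyGoodReductionFrobenius` (Néron model datum `nonempty_goodReductionAt`, `ℓ`-adic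
specialisation datum `nonempty_tateSpecialisation`, converse Néron–Ogg–Šafarevič `hasGoodReductionAt_of_isUnramifiedAt`) through which A-p04's
`shimuraTaniyama_heckeCharacters_of_thm18_6` derives row II-5 from row II-1.  HC_CM is proved only modulo the 7 printed citations until
rung 0 closes.  [cite: Shimura1998, §21.4 Thm. 21.4; §12.4 Prop. 26; Thm. 19.11] [cite: SerreTate1968, §7 Thm. 10–12; §1 Thm. 1] -/
theorem H21_of_thm18_6 (h186 : shimura1998_thm18_6) (hQbar : shimura1998_prop26_definedOverQbar)
    (h₁ : ∀ (k : Type) [Field k] [NumberField k] (A₀ : AbelianVariety k) (v : HeightOneSpectrum (𝓞 k)),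
      AbelianVariety.nonempty_goodReductionAt A₀ v)
    (h₂ : ∀ (k : Type) [Field k] [NumberField k] (A₀ : AbelianVariety k) (v : HeightOneSpectrum (𝓞 k))
      (R : A₀.GoodReductionAt v) (ℓ : ℕ) [Fact ℓ.Prime], R.nonempty_tateSpecialisation ℓ)
    (h₃ : ∀ (k : Type) [Field k] [NumberField k] (A₀ : AbelianVariety k) (v : HeightOneSpectrum (𝓞 k)),
      AbelianVariety.hasGoodReductionAt_of_isUnramifiedAt A₀ v) :
    Summit.HodgeConjecture.HodgeConjecture.Theses.HCCMUnconditional.H21 :=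
  H21_of_facts h186 (shimura1998_prop26_definedOverNumberField_of_definedOverQbar hQbar)
    (shimuraTaniyama_heckeCharacters_of_thm18_6 h186 h₁ h₂ h₃)

end Summit.HodgeConjecture.CorCM.Hyp21
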